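import Mathlib.Analysis.Real.Sqrt
import Mathlib.Algebra.Order.BigOperators.Ring.Finset
import Literature.Combinatorics.SimpleGraph.FKVertexForm
import HarnessLib

/-!
# Kunisky–Yu §3.2: the singleton block `H^{1,1}` and the second Schur complement, eigenvalue-free

Continuation of `FKVertexForm.lean` (Kunisky–Yu 2022, arXiv:2211.02713). For a graph `G` whose
Seidel matrix `S` (`+1` on edges, `−1` off edges, `0` diagonal, hypothesis `hS`) has zero row sums
and satisfies `S² = qI − J` (a conference graph; the Paley graph by `PaleySosProofs.lean`), we bound
the singleton block of `H` from below and minimise the vertex form over the singleton coordinates: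

* `kyEntry_singleton_singleton` — `H({a},{b}) = α₂/2 + (α₂/2) S_{ab} − α₁² + (α₁ − α₂/2)[a = b]`
  (KY (35), (41): `H^{1,1} = α₁I + α₂A − α₁²J` with `A = (S + J − I)/2`).
* `sum_sum_mul_seidel_ge` — `uᵀ S u ≥ −√q ‖u − ū𝟙‖²` from `‖Su‖² = q‖u‖² − (𝟙ᵀu)²` and
  Cauchy–Schwarz (replaces the spectrum `±√q` of `S`, KY Proposition 2.5 / (42)).
* `block11_ge` — KY Proposition 3.6 in the form
  `uᵀH^{1,1}u ≥ a₋‖u − ū𝟙‖² + A₀(𝟙ᵀu)²`, `a₋ = α₁ − (α₂/2)(1 + √q)`,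
  `A₀ = (α₁ − α₂/2)/q + α₂/2 − α₁²`.
* `kyVertexForm_nonneg_of_schur` — **the second Schur complement step** (KY (43)–(47),
  Proposition 3.7, with `(H^{1,1})^{-1} ⪯ a₀^{-1}Q₀ + a₋^{-1}Q₁` replaced by completing two
  squares):
  if `w_a = Σ_{c,d} Vm_{cd} H({a},{c,d})` and `F = ¼ Σ Vm_{ab}Vm_{cd}H({a,b},{c,d})` satisfy
  `(Σ_a w_a)²/(4A₀q²) + Σ_a (w_a − t)²/(4a₋) ≤ F` for some `t`, then `kyVertexForm G α u Vm ≥ 0`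
  for every `u`.

## References

* [KuniskyYu2022] D. Kunisky, X. Yu, arXiv:2211.02713, (35), (41)–(47), Propositions 3.6–3.7.
-/

noncomputable section

namespace Literature.Combinatorics.SimpleGraph

open Matrix Finset

section Schur

variable {V : Type*} [Fintype V] [DecidableEq V] (G : _root_.SimpleGraph V) [DecidableRel G.Adj]

/-- **The singleton block of `H`** (KY (35) and (41), `H^{1,1} = α₁I + α₂A_G − α₁²J`, with the
adjacency matrix written through the Seidel matrix, `A = (S + J − I)/2`):
`H({a},{b}) = α₂/2 + (α₂/2)S_{ab} − α₁² + (α₁ − α₂/2)[a = b]`. [cite: KuniskyYu2022, (41)] -/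
theorem kyEntry_singleton_singleton {S : Matrix V V ℝ}
    (hS : ∀ a b, S a b = if a = b then 0 else if G.Adj a b then 1 else -1) (α : ℕ → ℝ) (a b : V) :
    kyEntry G α {a} {b} =
      α 2 / 2 + α 2 / 2 * S a b - α 1 ^ 2 + (if a = b then α 1 - α 2 / 2 else 0) := by
  rw [kyEntry, bipInd_apply, hS]
  by_cases hab : a = b
  · subst hab
    have h : ∀ v ∈ ({a} : Finset V) \ {a}, ∀ w ∈ ({a} : Finset V) \ {a}, G.Adj v w := by simp
    rw [if_pos h, union_self, card_singleton, if_pos rfl, if_pos rfl]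
    ring
  · have hu : ({a} : Finset V) ∪ {b} = {a, b} := by rw [insert_eq]
    have hc : ({a, b} : Finset V).card = 2 := card_pair hab
    have hsd1 : ({a} : Finset V) \ {b} = {a} := by
      ext v; simp only [mem_sdiff, mem_singleton]; constructor
      · exact fun h => h.1
      · intro h; exact ⟨h, fun h' => hab (h.symm.trans h')⟩
    have hsd2 : ({b} : Finset V) \ {a} = {b} := by
      ext v; simp only [mem_sdiff, mem_singleton]; constructor
      · exact fun h => h.1
      · intro h; exact ⟨h, fun h' => hab (h'.symm.trans h)⟩
    have hiff : (∀ v ∈ ({a} : Finset V) \ {b}, ∀ w ∈ ({b} : Finset V) \ {a}, G.Adj v w) ↔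
        G.Adj a b := by
      rw [hsd1, hsd2]; simp
    rw [hu, hc, card_singleton, card_singleton, if_neg hab, if_neg hab]
    by_cases hadj : G.Adj a b
    · rw [if_pos (hiff.2 hadj), if_pos hadj]; ring
    · rw [if_neg (fun h => hadj (hiff.1 h)), if_neg hadj]; ring

/-- **The singleton block as a quadratic form**:
`Σ_{a,b} u_a u_b H({a},{b}) = (α₁ − α₂/2)‖u‖² + (α₂/2 − α₁²)(𝟙ᵀu)² + (α₂/2) uᵀSu`.
[cite: KuniskyYu2022, (41)] -/
theorem block11_eq {S : Matrix V V ℝ}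
    (hS : ∀ a b, S a b = if a = b then 0 else if G.Adj a b then 1 else -1) (α : ℕ → ℝ) (u : V → ℝ) :
    ∑ a, ∑ b, u a * u b * kyEntry G α {a} {b} =
      (α 1 - α 2 / 2) * ∑ a, u a ^ 2 + (α 2 / 2 - α 1 ^ 2) * (∑ a, u a) ^ 2 +
        α 2 / 2 * ∑ a, ∑ b, u a * S a b * u b := by
  have e : ∀ a b, u a * u b * kyEntry G α {a} {b} =
      u a * u b * (α 2 / 2 + α 2 / 2 * S a b - α 1 ^ 2) +
        (if a = b then u a * u b * (α 1 - α 2 / 2) else 0) := by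
    intro a b
    rw [kyEntry_singleton_singleton G hS]
    split_ifs <;> ring
  simp only [e, Finset.sum_add_distrib, Finset.sum_ite_eq, Finset.mem_univ, if_true]
  have p1 : ∑ a, ∑ b, u a * u b * (α 2 / 2 + α 2 / 2 * S a b - α 1 ^ 2) =
      (α 2 / 2 - α 1 ^ 2) * ∑ a, ∑ b, u a * u b + α 2 / 2 * ∑ a, ∑ b, u a * S a b * u b := by
    rw [Finset.mul_sum, Finset.mul_sum, ← Finset.sum_add_distrib]
    refine Finset.sum_congr rfl fun a _ => ?_
    rw [Finset.mul_sum, Finset.mul_sum, ← Finset.sum_add_distrib]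
    exact Finset.sum_congr rfl fun b _ => by ring
  have p2 : ∑ a, u a * u a * (α 1 - α 2 / 2) = (α 1 - α 2 / 2) * ∑ a, u a ^ 2 := by
    rw [Finset.mul_sum]; exact Finset.sum_congr rfl fun a _ => by ring
  rw [p1, p2, sq (∑ a, u a), Finset.sum_mul_sum]
  ring

/-- **`‖Su‖² = q‖u‖² − (𝟙ᵀu)²`** for the Seidel matrix of a conference graph (`S² = qI − J`,
`S` symmetric). [cite: KuniskyYu2022, Proposition 4.6 (74)] -/
theorem sum_sq_seidel_mulVec {S : Matrix V V ℝ}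
    (hS : ∀ a b, S a b = if a = b then 0 else if G.Adj a b then 1 else -1)
    (hsq : S * S = (Fintype.card V : ℝ) • (1 : Matrix V V ℝ) - of fun _ _ => 1) (u : V → ℝ) :
    ∑ a, (∑ b, S a b * u b) ^ 2 = (Fintype.card V : ℝ) * ∑ a, u a ^ 2 - (∑ a, u a) ^ 2 := by
  have hSt : ∀ a b, S a b = S b a := by
    intro a b
    rw [hS, hS]
    by_cases h : a = b
    · subst h; rfl
    · rw [if_neg h, if_neg (Ne.symm h)]
      by_cases hadj : G.Adj a b
      · rw [if_pos hadj, if_pos hadj.symm]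
      · rw [if_neg hadj, if_neg (fun h' => hadj h'.symm)]
  -- `Σ_a (Su)_a² = Σ_{b,c} u_b u_c (S²)_{bc}`
  have h1 : ∑ a, (∑ b, S a b * u b) ^ 2 = ∑ b, ∑ c, u b * u c * (S * S) b c := by
    calc ∑ a, (∑ b, S a b * u b) ^ 2 = ∑ a, ∑ b, ∑ c, S a b * u b * (S a c * u c) := by
          refine Finset.sum_congr rfl fun a _ => ?_
          rw [sq, Finset.sum_mul_sum]
      _ = ∑ b, ∑ c, ∑ a, S a b * u b * (S a c * u c) := by
          rw [Finset.sum_comm]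
          exact Finset.sum_congr rfl fun b _ => Finset.sum_comm
      _ = ∑ b, ∑ c, u b * u c * (S * S) b c := by
          refine Finset.sum_congr rfl fun b _ => Finset.sum_congr rfl fun c _ => ?_
          rw [mul_apply, Finset.mul_sum]
          exact Finset.sum_congr rfl fun a _ => by rw [hSt a b]; ring
  rw [h1, hsq]
  have e : ∀ b c, u b * u c *
      ((((Fintype.card V : ℝ) • (1 : Matrix V V ℝ) - of fun _ _ => (1 : ℝ)) : Matrix V V ℝ) b c) =
        (if b = c then (Fintype.card V : ℝ) * (u b * u c) else 0) - u b * u c := by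
    intro b c
    simp only [Matrix.sub_apply, Matrix.smul_apply, one_apply, of_apply, smul_eq_mul]
    split_ifs <;> ring
  simp only [e, Finset.sum_sub_distrib, Finset.sum_ite_eq, Finset.mem_univ, if_true]
  rw [sq (∑ a, u a), Finset.sum_mul_sum, Finset.mul_sum]
  congr 1
  exact Finset.sum_congr rfl fun b _ => by ring

/-- **`uᵀSu ≥ −√q ‖u − ū𝟙‖²`** (`ū = 𝟙ᵀu/q`): the eigenvalue-free substitute for the bottom
eigenvalue `−(1+√q)/2` of the Paley adjacency matrix (KY Proposition 2.5, used in (42)); from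
`uᵀSu = (u−ū𝟙)ᵀS(u−ū𝟙)`, Cauchy–Schwarz and `‖S(u−ū𝟙)‖² ≤ q‖u−ū𝟙‖²`.
[cite: KuniskyYu2022, Proposition 2.5 and (42)] -/
theorem sum_sum_mul_seidel_ge {S : Matrix V V ℝ}
    (hS : ∀ a b, S a b = if a = b then 0 else if G.Adj a b then 1 else -1)
    (hrow : ∀ a, ∑ b, S a b = 0)
    (hsq : S * S = (Fintype.card V : ℝ) • (1 : Matrix V V ℝ) - of fun _ _ => 1) (u : V → ℝ) :
    -(Real.sqrt (Fintype.card V) * ∑ a, (u a - (∑ b, u b) / (Fintype.card V : ℝ)) ^ 2) ≤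
      ∑ a, ∑ b, u a * S a b * u b := by
  set q : ℝ := (Fintype.card V : ℝ) with hq
  set m : ℝ := (∑ b, u b) / q with hm
  set u' : V → ℝ := fun a => u a - m with hu'
  have hSt : ∀ a b, S a b = S b a := by
    intro a b
    rw [hS, hS]
    by_cases h : a = b
    · subst h; rfl
    · rw [if_neg h, if_neg (Ne.symm h)]
      by_cases hadj : G.Adj a b
      · rw [if_pos hadj, if_pos hadj.symm]
      · rw [if_neg hadj, if_neg (fun h' => hadj h'.symm)]
  have hcol : ∀ b, ∑ a, S a b = 0 := fun b => by
    rw [show ∑ a, S a b = ∑ a, S b a from Finset.sum_congr rfl fun a _ => hSt a b]; exact hrow b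
  -- `uᵀSu = u'ᵀSu'`
  have hquad : ∑ a, ∑ b, u a * S a b * u b = ∑ a, ∑ b, u' a * S a b * u' b := by
    have e : ∀ a b, u' a * S a b * u' b =
        u a * S a b * u b - m * (S a b * u b) - m * (u a * S a b) + m * m * S a b := by
      intro a b; simp only [hu']; ring
    have h1 : ∑ a, ∑ b, S a b * u b = 0 := by
      rw [Finset.sum_comm]
      exact Finset.sum_eq_zero fun b _ => by rw [← Finset.sum_mul, hcol b, zero_mul]
    have h2 : ∑ a, ∑ b, u a * S a b = 0 :=
      Finset.sum_eq_zero fun a _ => by rw [← Finset.mul_sum, hrow a, mul_zero]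
    have h3 : ∑ a, ∑ b, S a b = 0 := Finset.sum_eq_zero fun a _ => hrow a
    symm
    calc ∑ a, ∑ b, u' a * S a b * u' b
        = ∑ a, ∑ b, (u a * S a b * u b - m * (S a b * u b) - m * (u a * S a b) +
            m * m * S a b) :=
          Finset.sum_congr rfl fun a _ => Finset.sum_congr rfl fun b _ => e a b
      _ = ∑ a, ∑ b, u a * S a b * u b - m * ∑ a, ∑ b, S a b * u b -
            m * ∑ a, ∑ b, u a * S a b + m * m * ∑ a, ∑ b, S a b := by
          simp only [Finset.sum_add_distrib, Finset.sum_sub_distrib, Finset.mul_sum]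
      _ = ∑ a, ∑ b, u a * S a b * u b := by rw [h1, h2, h3]; ring
  -- Cauchy–Schwarz
  have hcs : (∑ a, u' a * (∑ b, S a b * u' b)) ^ 2 ≤
      (∑ a, u' a ^ 2) * ∑ a, (∑ b, S a b * u' b) ^ 2 :=
    Finset.sum_mul_sq_le_sq_mul_sq _ _ _
  have hSu : ∑ a, (∑ b, S a b * u' b) ^ 2 ≤ q * ∑ a, u' a ^ 2 := by
    rw [sum_sq_seidel_mulVec G hS hsq u']
    nlinarith [sq_nonneg (∑ a, u' a)]
  have hform : ∑ a, ∑ b, u' a * S a b * u' b = ∑ a, u' a * (∑ b, S a b * u' b) := by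
    refine Finset.sum_congr rfl fun a _ => ?_
    rw [Finset.mul_sum]
    exact Finset.sum_congr rfl fun b _ => by ring
  rw [hquad, hform]
  set X : ℝ := ∑ a, u' a * ∑ b, S a b * u' b with hX
  set N : ℝ := ∑ a, u' a ^ 2 with hN
  have hN0 : 0 ≤ N := Finset.sum_nonneg fun a _ => sq_nonneg _
  have hq0 : 0 ≤ q := by rw [hq]; exact Nat.cast_nonneg _
  have hX2 : X ^ 2 ≤ q * N ^ 2 := by
    calc X ^ 2 ≤ N * ∑ a, (∑ b, S a b * u' b) ^ 2 := hcs
      _ ≤ N * (q * N) := mul_le_mul_of_nonneg_left hSu hN0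
      _ = q * N ^ 2 := by ring
  -- `X ≥ -√q N`
  have hsq' : (Real.sqrt q * N) ^ 2 = q * N ^ 2 := by
    rw [mul_pow, Real.sq_sqrt hq0]
  have hpos : 0 ≤ Real.sqrt q * N := mul_nonneg (Real.sqrt_nonneg _) hN0
  nlinarith [sq_nonneg (X + Real.sqrt q * N), abs_le_of_sq_le_sq' (hsq'.symm ▸ hX2) hpos]

/-- **Kunisky–Yu, Proposition 3.6, eigenvalue-free form**: for `α₂ ≥ 0`,
`uᵀH^{1,1}u ≥ (α₁ − (α₂/2)(1+√q)) ‖u − ū𝟙‖² + ((α₁ − α₂/2)/q + α₂/2 − α₁²)(𝟙ᵀu)²`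
(KY (38)/(42): `H^{1,1} ⪰ (α₁ + (p−1)α₂/2 − pα₁²)Q₀ + (α₁ − o(α₁))Q₁`).
[cite: KuniskyYu2022, Proposition 3.6] -/
theorem block11_ge {S : Matrix V V ℝ}
    (hS : ∀ a b, S a b = if a = b then 0 else if G.Adj a b then 1 else -1)
    (hrow : ∀ a, ∑ b, S a b = 0)
    (hsq : S * S = (Fintype.card V : ℝ) • (1 : Matrix V V ℝ) - of fun _ _ => 1)
    (α : ℕ → ℝ) (hα2 : 0 ≤ α 2) (u : V → ℝ) :
    (α 1 - α 2 / 2 * (1 + Real.sqrt (Fintype.card V))) *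
        ∑ a, (u a - (∑ b, u b) / (Fintype.card V : ℝ)) ^ 2 +
      ((α 1 - α 2 / 2) / (Fintype.card V : ℝ) + (α 2 / 2 - α 1 ^ 2)) * (∑ a, u a) ^ 2 ≤
      ∑ a, ∑ b, u a * u b * kyEntry G α {a} {b} := by
  rcases isEmpty_or_nonempty V with hV | hV
  · simp
  set q : ℝ := (Fintype.card V : ℝ) with hq
  have hqpos : 0 < q := by rw [hq]; exact_mod_cast Fintype.card_pos
  rw [block11_eq G hS α u]
  have hpy : ∑ a, u a ^ 2 = ∑ a, (u a - (∑ b, u b) / q) ^ 2 + (∑ a, u a) ^ 2 / q := by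
    have e : ∀ a, (u a - (∑ b, u b) / q) ^ 2 =
        u a ^ 2 - 2 * ((∑ b, u b) / q) * u a + ((∑ b, u b) / q) ^ 2 := fun a => by ring
    simp only [e, Finset.sum_add_distrib, Finset.sum_sub_distrib, ← Finset.mul_sum, sum_const,
      card_univ, nsmul_eq_mul, ← hq]
    field_simp
    ring
  have hSge := sum_sum_mul_seidel_ge G hS hrow hsq u
  rw [← hq] at hSge
  rw [hpy]
  set X : ℝ := ∑ a, (u a - (∑ b, u b) / q) ^ 2 with hX
  set Z : ℝ := ∑ a, u a with hZ
  set T : ℝ := ∑ a, ∑ b, u a * S a b * u b with hT'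
  have hT : 0 ≤ T + Real.sqrt q * X := by linarith [hSge]
  have hprod : 0 ≤ α 2 / 2 * (T + Real.sqrt q * X) := mul_nonneg (by linarith) hT
  have key : (α 1 - α 2 / 2) * (X + Z ^ 2 / q) + (α 2 / 2 - α 1 ^ 2) * Z ^ 2 + α 2 / 2 * T -
      ((α 1 - α 2 / 2 * (1 + Real.sqrt q)) * X +
        ((α 1 - α 2 / 2) / q + (α 2 / 2 - α 1 ^ 2)) * Z ^ 2) =
      α 2 / 2 * (T + Real.sqrt q * X) := by ring
  linarith [key, hprod]

/-- **The second Schur complement, by completing squares** (KY (43)–(47) and Proposition 3.7: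
`H ⪰ 0` follows from `H^{1,1} ≻ 0` and `H^{2,2} ⪰ H^{2,1}(H^{1,1})^{-1}H^{1,2}`, with
`(H^{1,1})^{-1} ⪯ a₀^{-1}Q₀ + a₋^{-1}Q₁`). In vertex coordinates: writing the vertex form as
`uᵀH^{1,1}u + Σ_a u_a w_a + F` with `w_a = Σ_{c,d} Vm_{cd} H({a},{c,d})`, if
`0 < a₋ ≤ α₁ − (α₂/2)(1+√q)`,
`0 < A₀ ≤ (α₁ − α₂/2)/q + α₂/2 − α₁²`, `α₂ ≥ 0` and
`(Σ_a w_a)²/(4A₀q²) + Σ_a (w_a − t)²/(4a₋) ≤ F` for some real `t`, then the vertex form is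
nonnegative at `(u, Vm)` for every `u`. [cite: KuniskyYu2022, Proposition 3.7] -/
theorem kyVertexForm_nonneg_of_schur {S : Matrix V V ℝ}
    (hS : ∀ a b, S a b = if a = b then 0 else if G.Adj a b then 1 else -1)
    (hrow : ∀ a, ∑ b, S a b = 0)
    (hsq : S * S = (Fintype.card V : ℝ) • (1 : Matrix V V ℝ) - of fun _ _ => 1)
    (α : ℕ → ℝ) (hα2 : 0 ≤ α 2) {am A0 : ℝ} (ham : 0 < am) (hA0 : 0 < A0)
    (ham_le : am ≤ α 1 - α 2 / 2 * (1 + Real.sqrt (Fintype.card V)))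
    (hA0_le : A0 ≤ (α 1 - α 2 / 2) / (Fintype.card V : ℝ) + (α 2 / 2 - α 1 ^ 2))
    (Vm : Matrix V V ℝ) (t : ℝ)
    (hF : (∑ a, ∑ c, ∑ d, Vm c d * kyEntry G α {a} {c, d}) ^ 2 /
          (4 * A0 * (Fintype.card V : ℝ) ^ 2) +
        (∑ a, ((∑ c, ∑ d, Vm c d * kyEntry G α {a} {c, d}) - t) ^ 2) / (4 * am) ≤
        (1 / 4) * ∑ a, ∑ b, ∑ c, ∑ d, Vm a b * Vm c d * kyEntry G α {a, b} {c, d})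
    (u : V → ℝ) : 0 ≤ kyVertexForm G α u Vm := by
  rcases isEmpty_or_nonempty V with hV | hV
  · simp [kyVertexForm]
  set q : ℝ := (Fintype.card V : ℝ) with hq
  have hqpos : 0 < q := by rw [hq]; exact_mod_cast Fintype.card_pos
  set w : V → ℝ := fun a => ∑ c, ∑ d, Vm c d * kyEntry G α {a} {c, d} with hw
  set F : ℝ := (1 / 4) * ∑ a, ∑ b, ∑ c, ∑ d, Vm a b * Vm c d * kyEntry G α {a, b} {c, d} with hFd
  set Z : ℝ := ∑ a, u a with hZ
  set u' : V → ℝ := fun a => u a - Z / q with hu'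
  set X2 : ℝ := ∑ a, (u a - Z / q) ^ 2 with hX2
  set Y2 : ℝ := ∑ a, (w a - t) ^ 2 with hY2
  set Wsum : ℝ := ∑ a, w a with hWsum
  -- the three parts of the vertex form
  have hsplit : kyVertexForm G α u Vm =
      ∑ a, ∑ b, u a * u b * kyEntry G α {a} {b} + ∑ a, u a * w a + F := by
    simp only [kyVertexForm, hw, hFd, Finset.mul_sum]
    congr 1; congr 1
    exact Finset.sum_congr rfl fun a _ => Finset.sum_congr rfl fun c _ =>
      Finset.sum_congr rfl fun d _ => by ring
  have h11 := block11_ge G hS hrow hsq α hα2 u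
  -- cross term: `Σ u_a w_a = (Z/q) Σ w_a + Σ u'_a (w_a - t)`
  have hcross : ∑ a, u a * w a = Z / q * Wsum + ∑ a, u' a * (w a - t) := by
    have hu0 : ∑ a, u' a = 0 := by
      simp only [hu', Finset.sum_sub_distrib, sum_const, card_univ, nsmul_eq_mul, ← hq, ← hZ]
      field_simp
      ring
    have e : ∀ a, u a * w a = Z / q * w a + u' a * (w a - t) + t * u' a := fun a => by
      simp only [hu']; ring
    simp only [e, Finset.sum_add_distrib, ← Finset.mul_sum, hu0, mul_zero, add_zero]
    rfl
  have h11' := h11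
  rw [← hq] at h11'
  have hcs : (∑ a, u' a * (w a - t)) ^ 2 ≤ X2 * Y2 := Finset.sum_mul_sq_le_sq_mul_sq _ _ _
  have hX0 : 0 ≤ X2 := Finset.sum_nonneg fun a _ => sq_nonneg _
  have hY0 : 0 ≤ Y2 := Finset.sum_nonneg fun a _ => sq_nonneg _
  -- `Σ u' (w - t) ≥ -√(X2 Y2)`
  set C : ℝ := ∑ a, u' a * (w a - t) with hC
  have hClow : -(Real.sqrt X2 * Real.sqrt Y2) ≤ C := by
    have h1 : (Real.sqrt X2 * Real.sqrt Y2) ^ 2 = X2 * Y2 := by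
      rw [mul_pow, Real.sq_sqrt hX0, Real.sq_sqrt hY0]
    have hpos : 0 ≤ Real.sqrt X2 * Real.sqrt Y2 := by positivity
    exact (abs_le_of_sq_le_sq' (h1.symm ▸ hcs) hpos).1
  -- assemble: `Q ≥ am X2 - √X2 √Y2 + A0 Z² + (Z/q) Wsum + F ≥ 0`
  have hFge : Wsum ^ 2 / (4 * A0 * q ^ 2) + Y2 / (4 * am) ≤ F := hF
  have hsx : Real.sqrt X2 ^ 2 = X2 := Real.sq_sqrt hX0
  have hsy : Real.sqrt Y2 ^ 2 = Y2 := Real.sq_sqrt hY0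
  rw [hsplit, hcross]
  have key1 : am * X2 - Real.sqrt X2 * Real.sqrt Y2 + Y2 / (4 * am) ≥ 0 := by
    have : am * X2 - Real.sqrt X2 * Real.sqrt Y2 + Y2 / (4 * am) =
        (2 * am * Real.sqrt X2 - Real.sqrt Y2) ^ 2 / (4 * am) := by
      field_simp
      linear_combination (-4 * am ^ 2) * hsx - hsy
    rw [this]; positivity
  have key2 : A0 * Z ^ 2 + Z / q * Wsum + Wsum ^ 2 / (4 * A0 * q ^ 2) ≥ 0 := by
    have : A0 * Z ^ 2 + Z / q * Wsum + Wsum ^ 2 / (4 * A0 * q ^ 2) =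
        (2 * A0 * q * Z + Wsum) ^ 2 / (4 * A0 * q ^ 2) := by
      field_simp
      ring
    rw [this]; positivity
  have ham' : am * X2 ≤ (α 1 - α 2 / 2 * (1 + Real.sqrt q)) * X2 :=
    mul_le_mul_of_nonneg_right ham_le hX0
  have hA0' : A0 * Z ^ 2 ≤ ((α 1 - α 2 / 2) / q + (α 2 / 2 - α 1 ^ 2)) * Z ^ 2 :=
    mul_le_mul_of_nonneg_right hA0_le (sq_nonneg _)
  nlinarith [h11', hClow, key1, key2, ham', hA0', hFge]

end Schur

end Literature.Combinatorics.SimpleGraph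

end
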